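import Summits.NavierStokesRegularity.NavierStokesRegularity.Theorems.SwirlFreeBudgetRadQuotLocal
import Summits.NavierStokesRegularity.NavierStokesRegularity.Theorems.SwirlFreeBudgetCutoff
import Literature.Analysis.FluidPDE.AxisymNoSwirlScaleInvariantBounds
import HarnessLib

/-!
# SwirlFreeBudget, brick for crux K-18.2 (T-18.5): the azimuthal-vorticity dictionary
# `‖ω‖ = r |ω_θ/r|` for fields smooth only on an axis-centred ball (seat nsreg-p4)

Support file for the DORMANT route `SwirlThreshold` (crux stmt-NavierStokesRegularity-2002) and
planner nsreg-p2's ROUND-18 assembly task T-18.5.  Assembles the three bricks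
(`…SwirlFreeBudgetCutoff`: axisymmetric swirl-free cut-off globalisation;
`…SwirlFreeBudgetRadQuotLocal`: locality of `radQuot`; the tree dictionary
`Literature.Analysis.FluidPDE.norm_curl_eq_cylRadius_mul_abs_angVortQuot` for globally `C³` fields)
into the statement `EtaMoserBound` consumers need:

* `norm_curl_eq_cylRadius_mul_abs_angVortQuot_of_ball`: for `c` on the axis and `V` axisymmetric,
  swirl free, and `C³` on `ball c R`: **`‖curl V x‖ = r(x) · |angVortQuot V x|` for every
  `x ∈ ball c R`** — so a bound `|angVortQuot V| ≤ Λ` on an axis-centred region of radius `ρ` gives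
  `‖curl V‖ ≤ Λ ρ` there (`norm_curl_le_of_abs_angVortQuot_le`), the input of the local Helmholtz sup
  bound `…EulerScaling.exists_const_norm_le_of_curl_le_local`.

WHAT THIS IS NOT: not NS regularity — calculus bookkeeping; `EtaMoserBound`,
`SwirlFreePolynomialBound` and all hard cores untouched; no crux claim.
-/

namespace Summit.NavierStokesRegularity.NavierStokesRegularity.Theorems.SwirlFreeBudget

open Set Filter Topology Metric
open Literature.Analysis Literature.Analysis.FluidPDE

noncomputable section

/-- If two fields agree near `y`, their curls agree at `y`. -/
theorem curl_congr_of_eventuallyEq {V W : EuclideanSpace ℝ (Fin 3) → EuclideanSpace ℝ (Fin 3)}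
    {y : EuclideanSpace ℝ (Fin 3)} (h : W =ᶠ[𝓝 y] V) : curl W y = curl V y := by
  simp only [curl, h.fderiv_eq]

/-- **THE DICTIONARY ON AN AXIS-CENTRED BALL**: for `c` on the axis and `V` axisymmetric, swirl free
and `C³` on `ball c R`, `‖curl V x‖ = r(x) |angVortQuot V x|` at every `x ∈ ball c R`. -/
theorem norm_curl_eq_cylRadius_mul_abs_angVortQuot_of_ball
    {V : EuclideanSpace ℝ (Fin 3) → EuclideanSpace ℝ (Fin 3)} {c : EuclideanSpace ℝ (Fin 3)}
    (hc : cylRadius c = 0) {R : ℝ} (hV : ContDiffOn ℝ 3 V (ball c R)) (hax : IsAxisymmetric V)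
    (hsw : HasNoSwirl V) {x : EuclideanSpace ℝ (Fin 3)} (hx : x ∈ ball c R) :
    ‖curl V x‖ = cylRadius x * |angVortQuot V x| := by
  -- a radius `R'` with `dist x c < R' < R`, and the globalisation `W` of `V` from `ball c R'`
  obtain ⟨R', hxR', hR'R⟩ := exists_between (mem_ball.1 hx)
  have hR'0 : 0 < R' := lt_of_le_of_lt dist_nonneg hxR'
  obtain ⟨W, hW, hWax, hWsw, hWV⟩ :=
    exists_contDiff_axisymmetric_hasNoSwirl_eqOn (n := 3) hc hR'0 hR'R hV hax hsw
  have hxR : x ∈ ball c R' := mem_ball.2 hxR'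
  -- `curl W = curl V` on `ball c R'`, hence `swirl (curl W) = swirl (curl V)` there
  have hcurl : ∀ y ∈ ball c R', curl W y = curl V y := fun y hy =>
    curl_congr_of_eventuallyEq (hWV.eventuallyEq_of_mem (isOpen_ball.mem_nhds hy))
  have hswirl : EqOn (swirl (curl V)) (swirl (curl W)) (ball c R') := by
    intro y hy
    simp only [swirl, hcurl y hy]
  -- locality of the radial quotient and the global dictionary for `W`
  have hq : angVortQuot V x = angVortQuot W x := by
    unfold angVortQuot
    exact radQuot_congr_of_eqOn_ball hc hswirl hxR
  rw [← hcurl x hxR, hq]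
  exact norm_curl_eq_cylRadius_mul_abs_angVortQuot hWax hWsw hW x

/-- The form consumed by the local Helmholtz bound: with `|angVortQuot V| ≤ Λ` on `ball c R` and
`cylRadius ≤ ρ` there (e.g. `R ≤ ρ`), `‖curl V‖ ≤ Λ ρ` on `ball c R`. -/
theorem norm_curl_le_of_abs_angVortQuot_le
    {V : EuclideanSpace ℝ (Fin 3) → EuclideanSpace ℝ (Fin 3)} {c : EuclideanSpace ℝ (Fin 3)}
    (hc : cylRadius c = 0) {R : ℝ} (hV : ContDiffOn ℝ 3 V (ball c R)) (hax : IsAxisymmetric V)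
    (hsw : HasNoSwirl V) {Λ ρ : ℝ} (hΛ : 0 ≤ Λ)
    (hbound : ∀ y ∈ ball c R, |angVortQuot V y| ≤ Λ) (hρ : ∀ y ∈ ball c R, cylRadius y ≤ ρ)
    {x : EuclideanSpace ℝ (Fin 3)} (hx : x ∈ ball c R) : ‖curl V x‖ ≤ Λ * ρ := by
  rw [norm_curl_eq_cylRadius_mul_abs_angVortQuot_of_ball hc hV hax hsw hx, mul_comm]
  exact mul_le_mul (hbound x hx) (hρ x hx) (cylRadius_nonneg x) hΛ

end

end Summit.NavierStokesRegularity.NavierStokesRegularity.Theorems.SwirlFreeBudget
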